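import Summits.CriticalPhenomena.PercolationContinuityZ3.Theses.PercNearOneGluing
import Literature.Probability.Percolation.PercolationProofs
import Literature.Probability.Percolation.ConditionalPositiveAssociationProofs
import Literature.Probability.Percolation.TwoClusterConditionalAssociationProofs
import Summits.CriticalPhenomena.PercolationContinuityZ3.Theorems.PercNearOneGluingAdditiveGluingBystanderGoodTwoRelays

/-! TTRL-lite variant V2084 of stmt-CriticalPhenomena-4576

(`stub_goodStep`, move `specialise+small_case`: `n := 6` and `A.card ≤ 3`).  With `b ∈ A` and
`A.card ≤ 3` there are at most two relays besides the target, and Kozma–Nitzan goodness in the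
skeleton's linear selection form holds UNCONDITIONALLY for every such quadruple `(w, A, o, b)`:
this is the landed two-relay kernel `stub_goodCardLeThree_k42`
(`…AdditiveGluingBystanderGoodTwoRelays.lean`: KN Theorem 1 strengthened by the dead-pocket
penalty, via the bystander form of KN Lemma 3).  The induction hypothesis, the low-neighbour
hypothesis and `n = 6` are not needed.  No new definitions, no named facts. -/

namespace Summit.CriticalPhenomena.PercolationContinuityZ3.Theorems

open MeasureTheory Literature.Probability.LatticeModels Literature.Probability.Percolation
open scoped Classical BigOperators

/-- TTRL-lite variant V2084 of `stub_goodStep` (stmt-CriticalPhenomena-4576): the `n = 6`,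
`A.card ≤ 3` specialisation of the additive-gluing good step.  At most two relays besides the
target `b`, so the conclusion is the unconditional two-relay goodness theorem
`stub_goodCardLeThree_k42` instantiated at `n = 6` (Kozma–Nitzan arXiv:2401.12397, Thm 1 p. 7 plus
the dead-pocket penalty of §3.2 p. 12); the induction and low-neighbour hypotheses are unused. -/
theorem stub_goodStep_var2084 : ∀ (w : Sym2 (Fin 6) → unitInterval) (A : Finset (Fin 6)) (o b : Fin 6), A.card ≤ 3 → b ∈ A → o ∉ A → (∃ y : Fin 6, y ∉ A ∧ y ≠ o ∧ (w s(o, y) : ℝ) ≠ 0) → (∀ w' : Sym2 (Fin 6) → unitInterval, (Finset.univ.filter (fun v : Fin 6 => ∃ u : Fin 6, 0 < (w' s(u, v) : ℝ))).card < (Finset.univ.filter (fun v : Fin 6 => ∃ u : Fin 6, 0 < (w s(u, v) : ℝ))).card → ∀ (A' : Finset (Fin 6)) (o' b' : Fin 6), b' ∈ A' → o' ∉ A' → ∀ (t : ℝ) (sel : Finset (Fin 6) → Fin 6), (∀ W, sel W ∈ A') → (∀ a ∈ A', 1 - t ≤ (prodBernoulli w').real (openConn a b')) → (prodBernoulli w').real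 ((⋃ a ∈ A', openConn o' a) ∩ (openConn o' b')ᶜ) + ∑ W ∈ (Finset.univ : Finset (Finset (Fin 6))).filter (fun W => o' ∈ W ∧ Disjoint W A'), (prodBernoulli w').real {ω : BondConfig (Fin 6) | openCluster ω o' = (W : Set (Fin 6))} * (prodBernoulli w').real (openConnIn ((W : Set (Fin 6))ᶜ) (sel W) b')ᶜ ≤ t) → ∀ (t : ℝ) (sel : Finset (Fin 6) → Fin 6), (∀ W, sel W ∈ A) → (∀ a ∈ A, 1 - t ≤ (prodBernoulli w).real (openConn a b)) → (prodBernoulli w).real ((⋃ a ∈ A, openConn o a) ∩ (openConn o b)ᶜ) + ∑ W ∈ (Finset.univ : Finset (Finset (Fin 6))).filter (fun W => o ∈ W ∧ Disjoint W A), (prodBernoulli w).real {ω : BondConfig (Fin 6) | openCluster ω o = (W : Set (Fin 6))} * (prodBernoulli w).real (openConnIn ((W : Set (Fin 6))ᶜ) (sel W) b)ᶜ ≤ t := by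
  intro w A o b hA hb ho _ _ t sel hsel ht
  exact stub_goodCardLeThree_k42 6 w A o b hb ho hA t sel hsel ht

end Summit.CriticalPhenomena.PercolationContinuityZ3.Theorems
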